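import Mathlib
import HarnessLib
import Summits.HubbardSuperconductivity.HubbardSuperconductivity.Theorems.KLProgrammeKLRegimeEngineV8TwoLegMomentsRaw
import Summits.HubbardSuperconductivity.HubbardSuperconductivity.Theorems.KLProgrammeKLRegimeEngineTwoLegCutLegStepSplit
import Summits.HubbardSuperconductivity.HubbardSuperconductivity.Theorems.KLProgrammeKLRegimeEngineTwoLegSpLegStepSplitRates

/-!
# K3 gen 8, ENGINE child `KLRegimeEngineV17F2` (stmt-HubbardSuperconductivity-20437), stub (e) `stub_twoLeg_step`: THE v2-READY CLOSER MODULO NAMED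
# PER-SCALE DATA — residual B as the raw two-leg moment atom + two fit lines, rows C1/C2 as per-scale point estimates on private rates, row A1 = stub (C)

Cell gate-hubbard-kl, seat hubbard-kl-r2d-p1 (g7).  Composition of this lane's three doors of record — `stub_twoLeg_step_of_twoLegMomentBounds_fits_GQJ`
(…EngineV8TwoLegMomentsRaw), `cutLeg_allScales_of_pointDefects_V17F2_rates` (…EngineTwoLegCutLegStepSplit, p549509) and k3c5-p2's
`spLeg_allScales_of_pointDefects_V17F2_rates` (…EngineTwoLegSpLegStepSplitRates, p548081) — into ONE statement whose hypothesis list IS the complete set of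
numbers the other lanes owe stub (e) at scale `n ≥ 1` (package `(G, Q)`, thresholds and jet tables as binders, the `_GQJ` convention):

* A1  `hJ : TwoLegReadJetBound L M cJ cJ' β U μ (K_n) n` — stub (C);
* B   `hD : TwoLegMomentBoundsAt L M Mt Ms β U μ (K_n) n` + the two FIT lines `2·Mt ≤ cz|U|`, `2·Ms + (4/3)Gfr₁U² ≤ cz|U|·cDtmin(−1.2,−0.05)/2` — the (b)
      tower's m = 2 export (v2 class #7, any law);
* C1  for every `m ≤ n`: (R) a gradient bound `b₁ m` of the `(L₁,M₁)`-reading on the frame-distance tube, (D) the common-point two-CUTOFF defect `d₁ m/L₁`,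
      on PRIVATE rates `a₁ m ≤ Q.CL β m/4` with the budget `b₁ m·(Σ_{j<m} a₁ j)/klCurveD + d₁ m ≤ a₁ m` — the VL lanes' sector-field step + k3c4-p2's mismatch resum;
* C2  the same for the SPATIAL leg `(L₁,M₂)/(L₂,M₂)` with `(a₂, b₂, d₂)`;
* `h0 : FrameOK R U (nScales β) μ 0` (the bare frame; `klFrameOK_zeroC` for a consumer in the route cone — kept as a hypothesis so this module stays outside it).

Conclusion: `TwoLegStepV17F2 L M G P Q R β U μ n`.  One theorem, **`stub_twoLeg_step_of_momentBounds_pointData_GQJ`**; proofs only (one composition); no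
definitions; nothing about the model is asserted; nothing asserts superconductivity.  References: BGM 2006 §2.4 (2.23), (2.36), Lemma 2.1 (2.40)
[cite: BenfattoGiulianiMastropietro2006].
-/

noncomputable section

namespace Summit.HubbardSuperconductivity.HubbardSuperconductivity.Theorems.EngineV8

set_option linter.dupNamespace false -- summit = problem name (single-conjunct summit), D-0017

open Real Finset Set Literature.MathematicalPhysics.QuantumLattice Literature.Probability.LatticeModels GrassmannAlgebra
open Literature.MathematicalPhysics.QuantumLattice.FermiRG Literature.MathematicalPhysics.QuantumLattice.BandSectorCounting
open Summit.HubbardSuperconductivity.HubbardSuperconductivity.Theorems.KLProgrammeLegKernels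
open Summit.HubbardSuperconductivity.HubbardSuperconductivity.Theorems.DispersionFlow
open Summit.HubbardSuperconductivity.HubbardSuperconductivity.Theorems.PerturbedFermiCurve
open Summit.HubbardSuperconductivity.HubbardSuperconductivity.Theorems.KLRegimeSplit
open Summit.HubbardSuperconductivity.HubbardSuperconductivity.Theorems.TwoPointAssembly
open Summit.HubbardSuperconductivity.HubbardSuperconductivity.Theorems.TwoLegFourier

/-- **STUB (e) OF 20437 MODULO NAMED PER-SCALE DATA (v2-ready, law-agnostic)** — see the module docstring for the hypothesis list (A1 = stub (C); B = raw
two-leg moment atom at `(K_n, n)` + two fit lines; C1/C2 = per-scale (R)/(D)/budget on private rates for the cutoff and the spatial nested legs; `h0`). -/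
theorem stub_twoLeg_step_of_momentBounds_pointData_GQJ (G : GeoConsts) (Q : EngConsts) (cJ cJ' : ℕ → ℝ) {c₃ U₀c : ℝ} (P : SplitConsts)
    (R : RenConsts) (c : ℝ) {Mt Ms : ℝ} {a₁ b₁ d₁ a₂ b₂ d₂ : ℕ → ℝ}
    (hGS : ∀ k, cJ k ≤ G.S k) (hQS : ∀ k, cJ' k ≤ Q.S' k) (hQCL : ∀ (β : ℝ) (n : ℕ), 0 ≤ Q.CL β n)
    (hc₃ : c₃ ≤ klEngC₃3 P R) (hU₀ : U₀c ≤ klEngU₀4 P R c) (hP : P.WF) (hR : R.WF2) (hc : 0 < c) (hc3 : c ≤ c₃)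
    (μ : ℝ) (hμ : μ ∈ klWindowC) (U : ℝ) (hU : 0 < U) (hUle : U ≤ U₀c) (β : ℝ) (hβ : klBetaMin ≤ β) (hβc : β ≤ Real.exp (c / U ^ 2))
    (L M : ℕ) [NeZero L] [NeZero M] (hL : klEngL₃ β U ≤ L) (hM : klEngM₃ β U L ≤ M)
    (n : ℕ) (hn1 : 1 ≤ n) (hn : n ≤ nScales β + 1) (hreg : IsKLRegime U c (-(n : ℤ)))
    (hhist : HistP klPredsV17F2 L M G P Q R β U μ 0 n)
    (hfr : FrameOK R U (nScales β) μ (klFlowFrameU L M β U μ n))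
    (hE : EngineBoundsAtV17F2 L M G P Q β U μ n)
    -- A1 = stub (C)
    (hJ : TwoLegReadJetBound L M cJ cJ' β U μ (klFlowFrameU L M β U μ n) n)
    -- B = the (b) tower's m = 2 export at `(K_n, n)`, raw budgets, and the two fit lines
    (hD : TwoLegMomentBoundsAt L M Mt Ms β U μ (klFlowFrameU L M β U μ n) n)
    (hzfit : 2 * Mt ≤ R.cz * |U|) (hsfit : 2 * Ms + 4 / 3 * R.Gfr 1 * U ^ 2 ≤ R.cz * |U| * (cDtmin (-1.2) (-0.05) / 2))
    -- the bare frame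
    (h0 : FrameOK R U (nScales β) μ 0)
    -- C1 = cutoff leg: private rates, (R), (D), budget at every scale `m ≤ n`
    (ha₁ : ∀ m ≤ n, a₁ m ≤ Q.CL β m / 4) (hb₁ : ∀ m ≤ n, 0 ≤ b₁ m)
    (hgrad₁ : ∀ m ≤ n, ∀ (Mq : ℕ → ℕ) (L₁ M₁ M₂ : ℕ) [NeZero L₁] [NeZero M₁] [NeZero M₂], L ≤ L₁ → Q.M0 β L₁ ≤ M₁ → Mq L₁ ≤ M₁ →
      M₁ ≤ M₂ →
      (∀ j < m, histV17F2 L₁ M₁ G P Q R β U μ j ∧ TwoLegSlopes L₁ M₁ R β U μ (klFlowFrameU L₁ M₁ β U μ j) j) →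
      (∀ j < m, histV17F2 L₁ M₂ G P Q R β U μ j ∧ TwoLegSlopes L₁ M₂ R β U μ (klFlowFrameU L₁ M₂ β U μ j) j) →
      (∀ j < m, ∀ θ : ℝ, |klLocalPart L₁ M₁ β U μ (klFlowFrameU L₁ M₁ β U μ j) j θ -
        klLocalPart L₁ M₂ β U μ (klFlowFrameU L₁ M₂ β U μ j) j θ| ≤ a₁ j / L₁) →
      (∀ q : Fin 2 → ℝ, |(klFlowFrameU L₁ M₁ β U μ m).eval q - (klFlowFrameU L₁ M₂ β U μ m).eval q| ≤ (∑ j ∈ range m, a₁ j) / L₁) →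
        ∀ q : Momentum, |frameLevel μ (klFlowFrameU L₁ M₁ β U μ m) q| ≤ (∑ j ∈ range m, a₁ j) / L₁ →
          ‖fderiv ℝ (evalM (symInterp L₁ (klLocSelfEnergyRe L₁ M₁ β U μ (klFlowFrameU L₁ M₁ β U μ m) m))) q‖ ≤ b₁ m)
    (hD₁ : ∀ m ≤ n, ∀ (Mq : ℕ → ℕ) (L₁ M₁ M₂ : ℕ) [NeZero L₁] [NeZero M₁] [NeZero M₂], L ≤ L₁ → Q.M0 β L₁ ≤ M₁ → Mq L₁ ≤ M₁ →
      M₁ ≤ M₂ →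
      (∀ j < m, histV17F2 L₁ M₁ G P Q R β U μ j ∧ TwoLegSlopes L₁ M₁ R β U μ (klFlowFrameU L₁ M₁ β U μ j) j) →
      (∀ j < m, histV17F2 L₁ M₂ G P Q R β U μ j ∧ TwoLegSlopes L₁ M₂ R β U μ (klFlowFrameU L₁ M₂ β U μ j) j) →
      (∀ j < m, ∀ θ : ℝ, |klLocalPart L₁ M₁ β U μ (klFlowFrameU L₁ M₁ β U μ j) j θ -
        klLocalPart L₁ M₂ β U μ (klFlowFrameU L₁ M₂ β U μ j) j θ| ≤ a₁ j / L₁) →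
      (∀ q : Fin 2 → ℝ, |(klFlowFrameU L₁ M₁ β U μ m).eval q - (klFlowFrameU L₁ M₂ β U μ m).eval q| ≤ (∑ j ∈ range m, a₁ j) / L₁) →
        ∀ θ : ℝ, |(symInterp L₁ (klLocSelfEnergyRe L₁ M₁ β U μ (klFlowFrameU L₁ M₁ β U μ m) m)).eval
              (klFermiPoint μ (klFlowFrameU L₁ M₂ β U μ m) θ) -
            (symInterp L₁ (klLocSelfEnergyRe L₁ M₂ β U μ (klFlowFrameU L₁ M₂ β U μ m) m)).eval
              (klFermiPoint μ (klFlowFrameU L₁ M₂ β U μ m) θ)| ≤ d₁ m / L₁)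
    (hbudget₁ : ∀ m ≤ n, b₁ m * (∑ j ∈ range m, a₁ j) / klCurveD + d₁ m ≤ a₁ m)
    -- C2 = spatial leg: private rates, (R), (D), budget at every scale `m ≤ n`
    (ha₂ : ∀ m ≤ n, a₂ m ≤ Q.CL β m / 4) (hb₂ : ∀ m ≤ n, 0 ≤ b₂ m)
    (hgrad₂ : ∀ m ≤ n, ∀ (Mq : ℕ → ℕ) (L₁ L₂ M₂ : ℕ) [NeZero L₁] [NeZero L₂] [NeZero M₂], L ≤ L₁ → L₁ ∣ L₂ → Q.M0 β L₁ ≤ M₂ →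
      Mq L₁ ≤ M₂ → Q.M0 β L₂ ≤ M₂ → Mq L₂ ≤ M₂ →
      (∀ j < m, histV17F2 L₁ M₂ G P Q R β U μ j ∧ TwoLegSlopes L₁ M₂ R β U μ (klFlowFrameU L₁ M₂ β U μ j) j) →
      (∀ j < m, histV17F2 L₂ M₂ G P Q R β U μ j ∧ TwoLegSlopes L₂ M₂ R β U μ (klFlowFrameU L₂ M₂ β U μ j) j) →
      (∀ j < m, ∀ θ : ℝ, |klLocalPart L₁ M₂ β U μ (klFlowFrameU L₁ M₂ β U μ j) j θ -
        klLocalPart L₂ M₂ β U μ (klFlowFrameU L₂ M₂ β U μ j) j θ| ≤ a₂ j / L₁) →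
      (∀ q : Fin 2 → ℝ, |(klFlowFrameU L₁ M₂ β U μ m).eval q - (klFlowFrameU L₂ M₂ β U μ m).eval q| ≤ (∑ j ∈ range m, a₂ j) / L₁) →
        ∀ q : Momentum, |frameLevel μ (klFlowFrameU L₁ M₂ β U μ m) q| ≤ (∑ j ∈ range m, a₂ j) / L₁ →
          ‖fderiv ℝ (evalM (symInterp L₁ (klLocSelfEnergyRe L₁ M₂ β U μ (klFlowFrameU L₁ M₂ β U μ m) m))) q‖ ≤ b₂ m)
    (hD₂ : ∀ m ≤ n, ∀ (Mq : ℕ → ℕ) (L₁ L₂ M₂ : ℕ) [NeZero L₁] [NeZero L₂] [NeZero M₂], L ≤ L₁ → L₁ ∣ L₂ → Q.M0 β L₁ ≤ M₂ →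
      Mq L₁ ≤ M₂ → Q.M0 β L₂ ≤ M₂ → Mq L₂ ≤ M₂ →
      (∀ j < m, histV17F2 L₁ M₂ G P Q R β U μ j ∧ TwoLegSlopes L₁ M₂ R β U μ (klFlowFrameU L₁ M₂ β U μ j) j) →
      (∀ j < m, histV17F2 L₂ M₂ G P Q R β U μ j ∧ TwoLegSlopes L₂ M₂ R β U μ (klFlowFrameU L₂ M₂ β U μ j) j) →
      (∀ j < m, ∀ θ : ℝ, |klLocalPart L₁ M₂ β U μ (klFlowFrameU L₁ M₂ β U μ j) j θ -
        klLocalPart L₂ M₂ β U μ (klFlowFrameU L₂ M₂ β U μ j) j θ| ≤ a₂ j / L₁) →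
      (∀ q : Fin 2 → ℝ, |(klFlowFrameU L₁ M₂ β U μ m).eval q - (klFlowFrameU L₂ M₂ β U μ m).eval q| ≤ (∑ j ∈ range m, a₂ j) / L₁) →
        ∀ θ : ℝ, |(symInterp L₁ (klLocSelfEnergyRe L₁ M₂ β U μ (klFlowFrameU L₁ M₂ β U μ m) m)).eval
              (klFermiPoint μ (klFlowFrameU L₂ M₂ β U μ m) θ) -
            (symInterp L₂ (klLocSelfEnergyRe L₂ M₂ β U μ (klFlowFrameU L₂ M₂ β U μ m) m)).eval
              (klFermiPoint μ (klFlowFrameU L₂ M₂ β U μ m) θ)| ≤ d₂ m / L₁)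
    (hbudget₂ : ∀ m ≤ n, b₂ m * (∑ j ∈ range m, a₂ j) / klCurveD + d₂ m ≤ a₂ m) :
    TwoLegStepV17F2 L M G P Q R β U μ n := by
  have hR' : ∀ j, 0 ≤ R.Gfr j := hR.1.2.2
  have hcle : c ≤ klCurveC3 R := (hc3.trans hc₃).trans (klEngC₃3_le_klCurveC3 P hR')
  have hUc : U ≤ klCurveU0 R := (le_klEngU₀3_of_le_klEngU₀4 (hUle.trans hU₀)).trans (klEngU₀3_le_klCurveU0 P hR' c)
  have hcut := cutLeg_allScales_of_pointDefects_V17F2_rates (L := L) (G := G) (P := P) (Q := Q) hR' hc hcle hU hUc hβ hβc hμ h0 hn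
    ha₁ hb₁ hgrad₁ hD₁ hbudget₁ n le_rfl
  have hsp := spLeg_allScales_of_pointDefects_V17F2_rates (L := L) (G := G) (P := P) (Q := Q) hR' hc hcle hU hUc hβ hβc hμ h0 hn
    ha₂ hb₂ hgrad₂ hD₂ hbudget₂ n le_rfl
  exact stub_twoLeg_step_of_twoLegMomentBounds_fits_GQJ G Q cJ cJ' P R c hGS hQS hQCL hc₃ hU₀ hP hR hc hc3 μ hμ U hU hUle β hβ hβc L M hL hM
    n hn1 hn hreg hhist hfr hE hJ hD hzfit hsfit hcut hsp

end Summit.HubbardSuperconductivity.HubbardSuperconductivity.Theorems.EngineV8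

end
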